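import Mathlib

/-!
# The vertical unit field `∂ₜ` on `M × ℝ`

Stub `stub_verticalUnitField` for the line `einstein-bulk-transfer` of the crux
`AhHadamardFilling`: on the product manifold `M × ℝ` (collar coordinates), the coordinate
vector field `∂ₜ`, i.e. the section `p ↦ (0, 1)` of `T(M × ℝ)`, is smooth.

The proof transports the pair (zero section of `TM`, constant unit vector field on `ℝ`)
through the smooth canonical identification `TM × Tℝ → T(M × ℝ)`
(`equivTangentBundleProd`, `contMDiff_equivTangentBundleProd_symm`).
-/

noncomputable section

set_option linter.dupNamespace false

open scoped Manifold ContDiff Topology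
open Set Function Bundle

namespace Summit.SmoothPoincare4.SmoothPoincare4.Cruxes.AhHadamardFilling.EinsteinBulkTransfer

/-- The coordinate vector field `∂ₜ` on the product manifold `M × ℝ`, i.e. the section
`p ↦ (0, 1)` of the tangent bundle `T(M × ℝ)`, is a smooth vector field. It is obtained by
transporting the pair (zero section of `TM`, constant unit field on `ℝ`) through the smooth
canonical identification `TM × Tℝ ≃ T(M × ℝ)` (`equivTangentBundleProd`). -/
theorem stub_verticalUnitField
    (M : Type) [TopologicalSpace M] [ChartedSpace (EuclideanSpace ℝ (Fin 4)) M]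
    [IsManifold (𝓡 4) ∞ M] :
    ContMDiff ((𝓡 4).prod 𝓘(ℝ, ℝ)) ((𝓡 4).prod 𝓘(ℝ, ℝ)).tangent ∞
      (fun p : M × ℝ =>
        (⟨p, ((0 : TangentSpace (𝓡 4) p.1), (1 : ℝ))⟩ : TangentBundle ((𝓡 4).prod 𝓘(ℝ, ℝ)) (M × ℝ))) := by
  -- the zero section of `TM`, precomposed with the first projection
  have h1 : ContMDiff ((𝓡 4).prod 𝓘(ℝ, ℝ)) (𝓡 4).tangent ∞
      (fun p : M × ℝ => (⟨p.1, 0⟩ : TangentBundle (𝓡 4) M)) :=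
    (Bundle.contMDiff_zeroSection ℝ (TangentSpace (𝓡 4) : M → Type)).comp contMDiff_fst
  -- the constant unit vector field on `ℝ`, precomposed with the second projection
  have h2 : ContMDiff ((𝓡 4).prod 𝓘(ℝ, ℝ)) 𝓘(ℝ, ℝ).tangent ∞
      (fun p : M × ℝ => (⟨p.2, 1⟩ : TangentBundle 𝓘(ℝ, ℝ) ℝ)) := by
    have h : ContMDiff 𝓘(ℝ, ℝ) 𝓘(ℝ, ℝ).tangent ∞
        (fun t : ℝ => (⟨t, (fun _ : ℝ => (1 : ℝ)) t⟩ : TangentBundle 𝓘(ℝ, ℝ) ℝ)) :=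
      contMDiff_vectorSpace_iff_contDiff.2 contDiff_const
    exact h.comp contMDiff_snd
  exact (contMDiff_equivTangentBundleProd_symm (n := ∞) (I := 𝓡 4) (M := M)
    (I' := 𝓘(ℝ, ℝ)) (M' := ℝ)).comp (h1.prodMk h2)

end Summit.SmoothPoincare4.SmoothPoincare4.Cruxes.AhHadamardFilling.EinsteinBulkTransfer
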